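import Summits.QuantumFields.YangMills.Theorems.UnitScaleTiltProp7PinnedKernelL1
import Summits.QuantumFields.YangMills.Theorems.UnitScaleTiltProp7CentreHarmonicInterpKernel
import Summits.QuantumFields.YangMills.Theorems.UnitScaleTiltProp7CentreHarmonicRegaugeSup
import Summits.QuantumFields.YangMills.Theorems.UnitScaleTiltProp7PinnedSupOfGradient
import HarnessLib

/-!
# Route `UnitScaleTilt`, crux K1 «MinimiserStabilityRegPr» (stmt-QuantumFields-19200), route-R E′ path (α′) — «S2-FLAT-CLOSE»: THE DISPLAYED INTERPOLATION ROW `hInterp` OF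
# ✓ `…CentreHarmonicRegaugeSup` IS DISCHARGED ON THE FINEST TORUS (`d = 3`, `1 ≤ k ≤ m + K`, `c ≠ 0`, `40 ≤ sitesPerDir k`, centres `C = range (embIter k)`): the flat LEMMA (S_H-SUP′)
# holds with an ABSOLUTE interpolation constant `c_I := Φ∕|c|` and NO displayed analytic row — only the (E) data (`Δφ = ∂^*A`, `φ_H` = a pinned interpolant of `φ|_C` biharmonic off `C`) remain as inputs

Cell `ym3-torus`, D-0154 (3c) twin-width seat `ym-routeR-w3` (gen 6), successor of the (hK)∕(A)∕(E1-b) lineage (★routeR-w3 g5 HANDOFF §5 step 2 «when px22's (F-b) is ✓: type the discharge of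
✓p653652's `hInterp` via ✓p654411 `norm_grad_interp_error_le`»).  THE CHAIN, all in the tree: (F-b) ✓p669951 `Prop7PinnedKernelL1.exists_green_kernel_l1_le` (px22 g2; over (R1)–(R5), (D1),
(D2′), (W1–3), Hess3, (N), (A0), (A1), (E), …) gives a pinned-biharmonic Green matrix `G` on `Site P 0` with `hG0`, `hGrep` and the kernel `ℓ¹` row `Σ_z|c·(Δ_c(G b₊) − Δ_c(G b₋))(z)| ≤ Φ·L^k∕|c|`;
(R) ✓p654411 turns it into `‖∂_c(φ − φ_H)(b)‖ ≤ (Φ·L^k∕|c|)·sup‖Δ_cφ‖`; ✓p653652 `sup_regauge_le_of_rows` consumes it with `c_I := Φ∕|c|`, `ℓ := L^k`; and ✓p670497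
`Prop7PinnedSupOfGradient.hInterp₀_flat_of_hInterp` adds the zeroth-order row for free.  THEOREMS ONLY (0 `def`, 0 `sorry`); `--supports stmt-QuantumFields-19200`, count-neutral.
YM₃ on T³ is a ladder rung (R3), not the Clay problem; nothing here claims the stub, the crux, d = 4 or the gap.

WHAT IS PROVED (ns `…Theorems.Prop7CentreHarmonicRegaugeSupT3`; `V : Type` a nontrivial real normed space, as in ✓p669951).
* §1 ★★ `exists_hInterp_const` — ONE absolute `Φ` such that on every such torus, for every `φ` and every pinned interpolant `φ_H` of `φ|_C` biharmonic off `C`: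
  `‖Δ_cφ‖ ≤ s₁ ⇒ ‖∂_c(φ − φ_H)(b)‖ ≤ (Φ·L^k∕|c|)·s₁` at every bond (the row `hInterp`), and `‖(φ − φ_H)(y)‖ ≤ (d∕2)·L^k·|c|⁻¹·(Φ·L^k∕|c|)·s₁` at every site (the row `hInterp₀`).
* §2 ★★★ `sup_regauge_le_of_rows_T3` — LEMMA (S_H-SUP′), FLAT, UNCONDITIONAL IN ITS ANALYTIC ROWS: with the same `Φ`, under the chart row `‖A(b)‖ ≤ s₀·(L^k)⁻¹` and the divergence row
  `‖∂^*_cA(x)‖ ≤ s₁′·((L^k)²)⁻¹`, for `Δ_cφ = ∂^*_cA` and `φ_H` as above, the re-gauged `A_H = A − ∂_c(φ − φ_H)` satisfies (i) `‖A_H(b)‖ ≤ (s₀ + (Φ∕|c|)·s₁′)·(L^k)⁻¹`, (ii) `curl A_H = curl A`,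
  (iii) `Δ_c(∂^*_cA_H) = 0` off `C`, (iv) `φ − φ_H = 0` on `C`, (v) `‖(φ − φ_H)(y)‖ ≤ (d·Φ∕(2c²))·s₁′` at every site.
HONEST SCOPE.  Composition only; the (E) data are hypotheses about the given `φ`, `φ_H` (they EXIST: flat Poisson ✓ `Prop7PinnedHodgeSplit.exists_hodgeSplit` (real-valued), pinned biharmonic
interpolant ✓p657675 (B5 carrier) ∕ ✓ `Prop7PinnedCovBiharmonicSolve` at `U = 1` — not re-derived here in `V`-valued `LatticeFieldCalculus` letters).  `Φ` is px22's astronomically large absolute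
constant.  Flat letters; the curved twin (P-cov2) is the routeR-w6 lineage.  Constants ours; nothing of print beyond the cited tree letters is asserted.

References: T. Bałaban, CMP 99 (1985) 75–102 [Balaban1985RegularSpaces] ((1.14) p.78, (1.36) p.82); CMP 95 (1984) 17–40 [Balaban1984PropagatorsI] ((1.4) p.18, (1.21) p.21);
CMP 96 (1984) 223–250 [Balaban1984PropagatorsII] ((1.9) p.226, (2.8) p.224); CMP 102 (1985) 277–309 [Balaban1985Variational] (Prop. 7 p.299).
-/

set_option autoImplicit false

noncomputable section

open scoped BigOperators

namespace Summit.QuantumFields.YangMills.Theorems.Prop7CentreHarmonicRegaugeSupT3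

open Literature.MathematicalPhysics.QuantumFieldTheory.Balaban1983to89
open LatticeFieldCalculus
open B15DeterminingSets (embIter)
open Summit.QuantumFields.YangMills.Theorems.Prop7PinnedKernelL1 (exists_green_kernel_l1_le)
open Summit.QuantumFields.YangMills.Theorems.Prop7CentreHarmonicInterpKernel (norm_grad_interp_error_le)
open Summit.QuantumFields.YangMills.Theorems.Prop7CentreHarmonicRegaugeSup (sup_regauge_le_of_rows)
open Summit.QuantumFields.YangMills.Theorems.Prop7PinnedSupOfGradient (norm_le_of_vanish_centres_grad)

/-! ## §1 ★★ The interpolation rows with one absolute constant -/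

/-- ★★ **`hInterp` (and `hInterp₀`) DISCHARGED ON THE FINEST TORUS**: there is an absolute `Φ` such that for every run `P` with `d = 3`, every `1 ≤ k ≤ m + K`, every lattice factor `c ≠ 0` with
`40 ≤ sitesPerDir k`, every nontrivial real normed `V`, every `φ : Site P 0 → V` and every `φ_H` agreeing with `φ` on the k-centres and `Δ_c`-biharmonic off them, and every sup bound `s₁` of `Δ_cφ`:
`‖∂_c(φ − φ_H)(b)‖ ≤ (Φ·L^k∕|c|)·s₁` at every bond and `‖(φ − φ_H)(y)‖ ≤ (d∕2)·L^k·(|c|⁻¹·((Φ·L^k∕|c|)·s₁))` at every site.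
[cite: Balaban1985RegularSpaces, (1.36) p.82, (1.14) p.78; Balaban1984PropagatorsI, (1.4) p.18] -/
theorem exists_hInterp_const : ∃ Φ : ℝ, ∀ (P : Params) (_ : P.d = 3) (k : ℕ) (_ : k ≤ P.m + P.K) (_ : 1 ≤ k) (c : ℝ) (_ : c ≠ 0)
    (_ : 40 ≤ P.sitesPerDir k) (V : Type) [NormedAddCommGroup V] [NormedSpace ℝ V] [Nontrivial V]
    (φ φH : SiteField P 0 V), (∀ y ∈ Set.range (embIter (P := P) k), φH y = φ y) →
    (∀ z ∉ Set.range (embIter (P := P) k), laplace c (laplace c φH) z = 0) →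
    ∀ (s₁ : ℝ), (∀ z, ‖laplace c φ z‖ ≤ s₁) →
      (∀ b : PBond P 0, ‖grad c (fun x => φ x - φH x) b‖ ≤ Φ * (P.L : ℝ) ^ k / |c| * s₁)
      ∧ (∀ y : Site P 0, ‖φ y - φH y‖ ≤ (P.d : ℝ) / 2 * (P.L : ℝ) ^ k * (|c|⁻¹ * (Φ * (P.L : ℝ) ^ k / |c| * s₁))) := by
  obtain ⟨Φ, hΦ⟩ := exists_green_kernel_l1_le
  refine ⟨Φ, ?_⟩
  intro P hd k hk hk1 c hc hM V _ _ _ φ φH hH hEL s₁ hs₁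
  obtain ⟨G, hG0, hGrep, hK⟩ := hΦ P hd k hk hk1 c hc hM V
  have hI : ∀ b : PBond P 0, ‖grad c (fun x => φ x - φH x) b‖ ≤ Φ * (P.L : ℝ) ^ k / |c| * s₁ := fun b =>
    norm_grad_interp_error_le c (Set.range (embIter (P := P) k)) G hGrep hG0 φ φH hH hEL hs₁ b (hK b)
  refine ⟨hI, fun y => ?_⟩
  have h0 : ∀ z : Site P k, (fun x => φ x - φH x) (embIter k z) = 0 := fun z => by
    simp only [hH (embIter k z) ⟨z, rfl⟩, sub_self]
  exact norm_le_of_vanish_centres_grad hk hc (fun x => φ x - φH x) h0 hI y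

/-! ## §2 ★★★ LEMMA (S_H-SUP′), flat, with no displayed analytic row -/

/-- ★★★ **LEMMA (S_H-SUP′), FLAT, ON THE FINEST TORUS — `hInterp` NO LONGER DISPLAYED.**  There is an absolute `Φ` such that for every `P` with `d = 3`, `1 ≤ k ≤ m + K`, `c ≠ 0`, `40 ≤ sitesPerDir k`,
nontrivial real normed `V`: if `‖A(b)‖ ≤ s₀·(L^k)⁻¹` ((1.36)₁), `‖∂^*_cA(x)‖ ≤ s₁′·((L^k)²)⁻¹` (the divergence row), `Δ_cφ = ∂^*_cA`, and `φ_H` agrees with `φ` on `range (embIter k)` and is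
`Δ_c`-biharmonic off it, then `A_H := A − ∂_c(φ − φ_H)` satisfies (i) `‖A_H(b)‖ ≤ (s₀ + (Φ∕|c|)·s₁′)·(L^k)⁻¹`, (ii) `curl_c A_H = curl_c A`, (iii) `Δ_c(∂^*_cA_H)(x) = 0` off the centres
(`A_H ∈ S_H`), (iv) `φ − φ_H` vanishes at the centres, (v) `‖(φ − φ_H)(y)‖ ≤ (d·Φ∕(2·c²))·s₁′`.
[cite: Balaban1985RegularSpaces, (1.36) p.82, (1.14) p.78; Balaban1985Variational, Prop. 7 p.299; Balaban1984PropagatorsII, (2.8) p.224] -/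
theorem sup_regauge_le_of_rows_T3 : ∃ Φ : ℝ, ∀ (P : Params) (_ : P.d = 3) (k : ℕ) (_ : k ≤ P.m + P.K) (_ : 1 ≤ k) (c : ℝ) (_ : c ≠ 0)
    (_ : 40 ≤ P.sitesPerDir k) (V : Type) [NormedAddCommGroup V] [NormedSpace ℝ V] [Nontrivial V]
    (A : VecField P 0 V) (φ φH : SiteField P 0 V) (s₀ s₁' : ℝ),
    (∀ b, ‖A b‖ ≤ s₀ * ((P.L : ℝ) ^ k)⁻¹) →
    laplace c φ = diverg c A →
    (∀ y ∈ Set.range (embIter (P := P) k), φH y = φ y) →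
    (∀ z ∉ Set.range (embIter (P := P) k), laplace c (laplace c φH) z = 0) →
    (∀ x, ‖diverg c A x‖ ≤ s₁' * (((P.L : ℝ) ^ k) ^ 2)⁻¹) →
      (∀ b, ‖gaugeShift c (fun x => φ x - φH x) A b‖ ≤ (s₀ + Φ / |c| * s₁') * ((P.L : ℝ) ^ k)⁻¹)
      ∧ (∀ p, curl c (gaugeShift c (fun x => φ x - φH x) A) p = curl c A p)
      ∧ (∀ x ∉ Set.range (embIter (P := P) k), laplace c (diverg c (gaugeShift c (fun x => φ x - φH x) A)) x = 0)
      ∧ (∀ x ∈ Set.range (embIter (P := P) k), (fun x => φ x - φH x) x = 0)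
      ∧ (∀ y : Site P 0, ‖φ y - φH y‖ ≤ (P.d * Φ / (2 * c ^ 2)) * s₁') := by
  obtain ⟨Φ, hΦ⟩ := exists_hInterp_const
  refine ⟨Φ, ?_⟩
  intro P hd k hk hk1 c hc hM V _ _ _ A φ φH s₀ s₁' hA hφ hH hEL hdiv
  have hℓ : (0 : ℝ) < (P.L : ℝ) ^ k := pow_pos (by exact_mod_cast P.L_pos) k
  have hℓne : (P.L : ℝ) ^ k ≠ 0 := hℓ.ne'
  have hca : |c| ≠ 0 := abs_ne_zero.mpr hc
  -- the sup bound of `Δ_cφ = ∂^*A`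
  have hs₁ : ∀ z, ‖laplace c φ z‖ ≤ s₁' * (((P.L : ℝ) ^ k) ^ 2)⁻¹ := fun z => by rw [hφ]; exact hdiv z
  obtain ⟨hI, hI₀⟩ := hΦ P hd k hk hk1 c hc hM V φ φH hH hEL _ hs₁
  -- `hInterp` in ✓p653652's currency with `c_I := Φ/|c|`, `ℓ := L^k`
  have hInterp : ∀ b : PBond P 0, ‖grad c (fun x => φ x - φH x) b‖ ≤ Φ / |c| * (P.L : ℝ) ^ k * (s₁' * (((P.L : ℝ) ^ k) ^ 2)⁻¹) := fun b => by
    have e : Φ * (P.L : ℝ) ^ k / |c| * (s₁' * (((P.L : ℝ) ^ k) ^ 2)⁻¹) = Φ / |c| * (P.L : ℝ) ^ k * (s₁' * (((P.L : ℝ) ^ k) ^ 2)⁻¹) := by ring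
    exact (hI b).trans_eq e
  obtain ⟨h1, h2, h3, h4⟩ := sup_regauge_le_of_rows c (Set.range (embIter (P := P) k)) A φ φH hℓ hA hφ hH hEL hInterp
  refine ⟨h1, h2, h3, h4, fun y => ?_⟩
  have e : (P.d : ℝ) / 2 * (P.L : ℝ) ^ k * (|c|⁻¹ * (Φ * (P.L : ℝ) ^ k / |c| * (s₁' * (((P.L : ℝ) ^ k) ^ 2)⁻¹))) = (P.d * Φ / (2 * c ^ 2)) * s₁' := by
    have e2 : c ^ 2 = |c| ^ 2 := (sq_abs c).symm
    rw [e2]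
    field_simp
  exact (hI₀ y).trans_eq e

end Summit.QuantumFields.YangMills.Theorems.Prop7CentreHarmonicRegaugeSupT3

end
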